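import Summits.CriticalPhenomena.PercolationContinuityZ3.Theorems.PercNearOneGluingNoHeavyLowerTailSahiE3Hit3PatternRows4
import Mathlib.Data.Fintype.Pi
import Mathlib.Data.Fin.VecNotation
import Mathlib.Tactic.Linarith
import Mathlib.Tactic.FinCases
import HarnessLib
import HarnessLib.Audit

/-!
# `NoHeavyLowerTail` (crux stmt-CriticalPhenomena-4575), Sahi programme P4 (Holley / monotone coupling):
# the `1+2+3` slot certificate on the pattern `2³` — combinatorial interface: Strassen domination

Support file (cell `prim-l12`, seat P4, generation 10; `--supports stmt-CriticalPhenomena-4575`).  No named facts, no sorries;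
standard axioms; def-free; no notation (the slot set is passed as `(M, hM : M = {100, 010, 001, 110, 101, 011, 111})`).  Notation and context as in `…SahiE3Hit3PatternRows`.
`dominance`: demands `Z·u·ν` on the points outside `OP`, capacities `Z(Z+d)ν − R` on `OP`: if the capacities are nonnegative, the Hall
inequalities of the canonical list hold and `Σ r = Z²u`, every up-set has demand ≤ capacity — the hypothesis of Strassen's theorem with slack
(`Literature…StrassenHolleyCoupling.exists_subcoupling_of_upperSets_le`), which yields the downward release flow with exact deliveries.
-/

namespace Summit.CriticalPhenomena.PercolationContinuityZ3.Theorems.SahiE3Hit3Pattern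

open Finset
open scoped BigOperators

/-- **Strassen domination for the release flow.**  Demands `dem = Z·u·ν` at the points outside `OP` (zero on `OP`), capacities
`cap_t = Z(Z+d)n_t − r_t ≥ 0` on `OP` (`cap ≥ 0` everywhere): if the Hall inequalities of the canonical list hold and `Σ r = Z²u`, then every
up-set `T` has demand at most capacity. [this work] -/
theorem dominance (dem cap : (Fin 3 → Bool) → ℝ) (cap0 : ∀ t, 0 ≤ cap t)
    (nE n0 n1 n2 n01 n02 n12 nT Z r0 r1 r2 r01 r02 r12 rT : ℝ) (nU nD : ℝ) (hZ : 0 ≤ Z) (hnE : 0 ≤ nE) (hn0 : 0 ≤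
        n0) (hn1 : 0 ≤ n1) (hn2 : 0 ≤ n2) (hn01 : 0 ≤ n01) (hn02 : 0 ≤ n02) (hn12 : 0 ≤ n12) (hnT : 0 ≤ nT)
    (dE : dem ![false, false, false] = Z * nU * nE) (d0 : dem ![true, false, false] = 0) (d1 : dem ![false, true,
        false] = 0) (d2 : dem ![false, false, true] = 0) (d01 : dem ![true, true, false] = 0) (d02 : dem ![true,
        false, true] = 0) (d12 : dem ![false, true, true] = 0) (dT : dem ![true, true, true] = 0)
    (k0 : cap ![true, false, false] = Z * (Z + nD) * n0 - r0) (k1 : cap ![false, true,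
        false] = Z * (Z + nD) * n1 - r1) (k2 : cap ![false, false, true] = Z * (Z + nD) * n2 - r2) (k01 : cap ![true,
        true, false] = Z * (Z + nD) * n01 - r01) (k02 : cap ![true, false,
        true] = Z * (Z + nD) * n02 - r02) (k12 : cap ![false, true,
        true] = Z * (Z + nD) * n12 - r12) (kT : cap ![true, true, true] = Z * (Z + nD) * nT - rT)
    (hnU : (n0 + n1 + n2 + n01 + n02 + n12 + nT) = nU) (hnD : nE = nD)
    (htot : r0 + r1 + r2 + r01 + r02 + r12 + rT = Z * Z * nU) :
    ∀ T : Finset (Fin 3 → Bool), IsUpperSet (T : Set (Fin 3 → Bool)) → ∑ z ∈ T, dem z ≤ ∑ z ∈ T, cap z := by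
  subst hnU hnD
  obtain ⟨hbot, htop, l_0_01, l_0_02, l_1_01, l_1_12, l_2_02, l_2_12⟩ := ord_hit3
  intro T hT
  have up : ∀ {x y : Fin 3 → Bool}, x ≤ y → x ∈ T → y ∈ T := fun hxy hx => hT hxy hx
  have hU : (0:ℝ) ≤ (n0 + n1 + n2 + n01 + n02 + n12 + nT) := by linarith only [hn0, hn1, hn2, hn01, hn02, hn12, hnT]
  have hD : (0:ℝ) ≤ nE := by linarith only [hnE]
  -- the demand of `T` sits on the points outside `OP`
  have S_dem : ∑ z ∈ T, dem z = (if ![false, false, false] ∈ T then dem ![false, false, false] else 0) := by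
    have e1 : ∑ z ∈ ({![false, false, false]} : Finset (Fin 3 → Bool)).filter (· ∈ T), dem z = ∑ z ∈ T, dem z := by
      refine Finset.sum_subset (fun x hx => (Finset.mem_filter.1 hx).2) fun x hxT hx => ?_
      have hx' : x ∉ ({![false, false, false]} : Finset (Fin 3 → Bool)) := fun h => hx (Finset.mem_filter.2 ⟨h, hxT⟩)
      rcases SahiE3MajPattern.pts x with rfl | rfl | rfl | rfl | rfl | rfl | rfl | rfl
      · exact absurd (by simp) hx'
      · exact d0
      · exact d1
      · exact d2
      · exact d01
      · exact d02
      · exact d12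
      · exact dT
    rw [← e1, Finset.sum_filter, Finset.sum_singleton]
  -- the capacity of `T` is at least that of its `OP`-part
  have S_cap : (if ![true, false, false] ∈ T then cap ![true, false, false] else 0) + ((if ![false, true,
      false] ∈ T then cap ![false, true, false] else 0) + ((if ![false, false, true] ∈ T then cap ![false, false,
      true] else 0) + ((if ![true, true, false] ∈ T then cap ![true, true, false] else 0) + ((if ![true, false,
      true] ∈ T then cap ![true, false, true] else 0) + ((if ![false, true, true] ∈ T then cap ![false, true,
      true] else 0) + ((if ![true, true, true] ∈ T then cap ![true, true, true] else 0))))))) ≤ ∑ z ∈ T, cap z := by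
    have e1 : ∑ z ∈ ({![true, false, false], ![false, true, false], ![false, false, true], ![true, true, false],
        ![true, false, true], ![false, true, true], ![true, true, true]} : Finset (Fin 3 → Bool)).filter (· ∈ T),
        cap z ≤ ∑ z ∈ T, cap z :=
      Finset.sum_le_sum_of_subset_of_nonneg (fun x hx => (Finset.mem_filter.1 hx).2) fun z _ _ => cap0 z
    rwa [Finset.sum_filter, Finset.sum_insert (by simp), Finset.sum_insert (by simp), Finset.sum_insert (by simp),
        Finset.sum_insert (by simp), Finset.sum_insert (by simp), Finset.sum_insert (by simp),
        Finset.sum_singleton] at e1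
  have g0 : 0 ≤ (if ![true, false, false] ∈ T then cap ![true, false, false] else 0) := by split_ifs; exacts [cap0 _,
      le_rfl]
  have g1 : 0 ≤ (if ![false, true, false] ∈ T then cap ![false, true, false] else 0) := by split_ifs; exacts [cap0 _,
      le_rfl]
  have g2 : 0 ≤ (if ![false, false, true] ∈ T then cap ![false, false, true] else 0) := by split_ifs; exacts [cap0 _,
      le_rfl]
  have g01 : 0 ≤ (if ![true, true, false] ∈ T then cap ![true, true, false] else 0) := by split_ifs; exacts [cap0 _,
      le_rfl]
  have g02 : 0 ≤ (if ![true, false, true] ∈ T then cap ![true, false, true] else 0) := by split_ifs; exacts [cap0 _,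
      le_rfl]
  have g12 : 0 ≤ (if ![false, true, true] ∈ T then cap ![false, true, true] else 0) := by split_ifs; exacts [cap0 _,
      le_rfl]
  have gT : 0 ≤ (if ![true, true, true] ∈ T then cap ![true, true, true] else 0) := by split_ifs; exacts [cap0 _,
      le_rfl]
  have qE : 0 ≤ Z * (n0 + n1 + n2 + n01 + n02 + n12 + nT) * nE := mul_nonneg (mul_nonneg hZ hU) hnE
  by_cases hb : ![false, false, false] ∈ T
  · -- `T = univ`
    have m : ∀ x, x ∈ T := fun x => up (hbot x) hb
    rw [if_pos hb, dE] at S_dem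
    rw [if_pos (m _), if_pos (m _), if_pos (m _), if_pos (m _), if_pos (m _), if_pos (m _), if_pos (m _), k0, k1, k2,
        k01, k02, k12, kT] at S_cap
    linarith
  rw [if_neg hb] at S_dem
  linarith

/-- `OP = {![true, false, false], ![false, true, false], ![false, false, true], ![true, true, false], ![true, false, true], ![false, true, true], ![true, true, true]}` is an up-set of the pattern. [folklore] -/
theorem isUpperSet_hit3 (M : Finset (Fin 3 → Bool))
    (hM : M = {![true, false, false], ![false, true, false], ![false, false, true], ![true, true, false], ![true,
        false, true], ![false, true, true], ![true, true,
        true]}) : IsUpperSet ((M : Finset (Fin 3 → Bool)) : Set (Fin 3 → Bool)) := by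
  subst hM
  letI : DecidableLE (Fin 3 → Bool) := fun a b => inferInstanceAs (Decidable (∀ i, a i ≤ b i))
  have h : ∀ a b : Fin 3 → Bool, a ≤ b → a ∈ ({![true, false, false], ![false, true, false], ![false, false, true],
      ![true, true, false], ![true, false, true], ![false, true, true], ![true, true,
      true]} : Finset (Fin 3 → Bool)) → b ∈ ({![true, false, false], ![false, true, false], ![false, false, true],
      ![true, true, false], ![true, false, true], ![false, true, true], ![true, true,
      true]} : Finset (Fin 3 → Bool)) := by decide
  intro a b hab ha
  exact h a b hab ha

end Summit.CriticalPhenomena.PercolationContinuityZ3.Theorems.SahiE3Hit3Pattern
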